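import Literature.IUT.LogVolume.InitialThetaDataVolume
import Literature.IUT.LogVolume.GenuineLogThetaSplitBadPrimes
import HarnessLib

/-!
# [IUTchIII] Cor. 3.12 (the tree's sharp Dupuy–Hilado-level `Cor312Of`) HOLDS for every Θ-volume input OF initial
# Θ-data whose `V^bad_mod` carries at most a third of `[F_mod:ℚ]` over each rational prime

Record/proof-only file of the abc-iut cell (Cor. 3.12 crew, L-DH lane, seat abc-iut-c312-3; item «XXVIIc-DH»; the
PRINTED-OBJECT form of `GenuineLogThetaSplitBadPrimes.lean`). TAKES NO SIDE on [IUTchIII] Cor. 3.12.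

[IUTchI] Def. 3.1 (kurims May-2020 pp. 61–62): initial Θ-data `(F̄/F, X_F, l, C̲_K, V̲, V^bad_mod, ε̲)`, (b) "`V^bad_mod
⊆ V_mod` is a nonempty set of nonarchimedean valuations of `F_mod` … such that `X_F` has bad [i.e., multiplicative]
reduction at the elements of `V(F)` that lie over `V^bad_mod`" — a CHOSEN set. abc-iut-S2's adapter
(`InitialThetaDataVolume.lean`: `ThetaData.pilotData D = (j_E, V^bad_mod, l)` over `F_mod = ℚ(j_E)`,
`ThetaData.IsVolumeInputOf D I`) makes every genuine Θ-volume input OF `D` an instance of c312-3's `ThetaVolumeInput`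
with `I.X.S = V^bad_mod`. Read through it, `ThetaVolumeInput.cor312Of_of_badMass_le_third` gives:

* **`ThetaData.cor312Of_of_isVolumeInputOf_of_badMass_le_third`** — for initial Θ-data `D` with
  `β_p(D) := Σ_{v ∈ V^bad_mod, v | p} [F_{mod,v}:ℚ_p]/[F_mod:ℚ] ≤ 1/3` at EVERY rational prime `p`, EVERY Θ-volume input
  `I` of `D` (every choice of the `2l`-th-root ideles in the genuine completions `K_{v̲}`) satisfies Dupuy–Hilado's (1.1)
  `Cor312NonarchOf I` AND `Cor312Of I` — whatever `X_F`, `l`, `K`, the depths `ord_v(q_v)`;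
* `ThetaData.cor312Of_volumeInputOf_of_badMass_le_third` — the same for the adapter's own input `volumeInputOf D r`.

So at the level of the printed object the cell's sharp L-DH fork reads: `F_mod = ℚ` (`j_E ∈ ℚ`), ONE deep bad prime ⇒
every per-prime/per-packet reading FALSE (abc-iut-w5-d157 `LDHInitialThetaDataPerPrime`); `V^bad_mod` of bad mass
`≤ 1/3` at each prime ⇒ the GLOBAL typed inequality TRUE at every depth (this file) — place combinatorics of
`(F_mod, V^bad_mod)`, orthogonal to the dispute. NOT constructed here: initial Θ-data with such a `V^bad_mod` (it needs
`[F_mod:ℚ] ≥ 3` and a bad place of relative local degree `≤ 1/3`; [IUTchIV] Cor. 2.2's data have `F_mod = ℚ(j_E)`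
arbitrary). HONEST SCOPE: a theorem about OUR typed objects ((Ind1) = all capsule-index permutations,
HOME/plan/c312/STEPV-IND1-NOTE.md ruling R2; sharp (Ind3); full (Ind2); genuine completions); it asserts nothing about
print's Cor. 3.12 for any curve and is no evidence either way in the dispute; on the `Summit.ABC` route `F_mod = ℚ` and
`β_p = 1`. [cite: Mochizuki2012, IUTchI Def. 3.1 (b)(e) p. 61–62] [cite: Mochizuki2012, IUTchIII Cor. 3.12 p. 173–174]
[cite: DupuyHilado2025, §1 (1.1), §3.3, §3.6] [claim: Mochizuki2012, status: disputed] for every IUT quotation.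
PROOF-ONLY file: no definitions, no named `Prop` facts; typed ≠ proved; instantiated ≠ endorsed.
-/

noncomputable section

namespace Literature.IUT.LogVolume

namespace ThetaData

open Literature.IUT.HodgeTheaters NumberField IsDedekindDomain

variable {F K Fbar : Type} [Field F] [NumberField F] [Field K] [NumberField K] [Algebra F K]
  [Field Fbar] [Algebra F Fbar] [Algebra K Fbar] {E : WeierstrassCurve F} [E.IsElliptic] {l : ℕ}
  {Pb : BadPlacePredicates K} (D : InitialThetaData F K Fbar E l Pb)

/-- **Cor. 3.12 (the tree's `Cor312Of`) for EVERY Θ-volume input OF initial Θ-data with bad mass `≤ 1/3`**: if at every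
rational prime `p` the places of `V^bad_mod` over `p` carry at most a third of `[F_mod:ℚ]`
(`Σ_{v ∈ V^bad_mod, v|p} Pr(v) ≤ 1/3`), then every genuine Θ-volume input `I` of `D` satisfies `Cor312NonarchOf I`
(Dupuy–Hilado (1.1)) and `Cor312Of I` — at every depth, for every `l`, `K` and idele choice. A theorem about OUR typed
objects; no side taken on print's Cor. 3.12. [claim: Mochizuki2012, status: disputed]
[cite: Mochizuki2012, IUTchI Def. 3.1 (b) p. 61] [cite: DupuyHilado2025, §1 (1.1), §3.6] -/
theorem cor312Of_of_isVolumeInputOf_of_badMass_le_third {I : ThetaVolumeInput (fieldOfModuli E) K}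
    (hI : IsVolumeInputOf D I)
    (h : ∀ p : ℕ, ∑ v : placesOver (fieldOfModuli E) p,
      (badPrimesMod D : Set (HeightOneSpectrum (𝓞 (fieldOfModuli E)))).indicator (weight (fieldOfModuli E)) v.1 ≤
        1 / 3) :
    I.Cor312NonarchOf ∧ I.Cor312Of := by
  refine I.cor312Of_of_badMass_le_third fun p _ => ?_
  rw [hI.X_eq]
  exact h p

/-- The same for the adapter's own input `volumeInputOf D r` (any idele data `r` over the genuine completions).
[claim: Mochizuki2012, status: disputed] [cite: Mochizuki2012, IUTchI Def. 3.1 (b) p. 61] [cite: DupuyHilado2025, §1 (1.1), §3.6] -/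
theorem cor312Of_volumeInputOf_of_badMass_le_third (r : IdeleData D)
    (h : ∀ p : ℕ, ∑ v : placesOver (fieldOfModuli E) p,
      (badPrimesMod D : Set (HeightOneSpectrum (𝓞 (fieldOfModuli E)))).indicator (weight (fieldOfModuli E)) v.1 ≤
        1 / 3) :
    (volumeInputOf D r).Cor312NonarchOf ∧ (volumeInputOf D r).Cor312Of :=
  cor312Of_of_isVolumeInputOf_of_badMass_le_third D (isVolumeInputOf_volumeInputOf D r) h

/-- **Sharper per-`l` form**: it suffices that `(1/ℓ⋇)·Σ_{i<ℓ⋇} (i+1)²·β_p(D)^{i+1} ≤ 1` at every support prime of the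
input (`ThetaVolumeInput.cor312Of_of_badMass_le`). [claim: Mochizuki2012, status: disputed]
[cite: Mochizuki2012, IUTchI Def. 3.1 (b) p. 61] [cite: DupuyHilado2025, §1 (1.1), §3.6] -/
theorem cor312Of_of_isVolumeInputOf_of_badMass_le {I : ThetaVolumeInput (fieldOfModuli E) K}
    (hI : IsVolumeInputOf D I)
    (h : ∀ p ∈ I.supportPrimes, (1 / (I.lstar : ℝ)) * ∑ i : Fin I.lstar, (((i : ℕ) + 1 : ℝ) ^ 2) *
      (∑ v : placesOver (fieldOfModuli E) p,
        (badPrimesMod D : Set (HeightOneSpectrum (𝓞 (fieldOfModuli E)))).indicator (weight (fieldOfModuli E)) v.1) ^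
          ((i : ℕ) + 1) ≤ 1) :
    I.Cor312NonarchOf ∧ I.Cor312Of := by
  have h' : ∀ p ∈ I.supportPrimes, (1 / (I.lstar : ℝ)) * ∑ i : Fin I.lstar, (((i : ℕ) + 1 : ℝ) ^ 2) *
      (∑ v : placesOver (fieldOfModuli E) p,
        (I.X.S : Set (HeightOneSpectrum (𝓞 (fieldOfModuli E)))).indicator (weight (fieldOfModuli E)) v.1) ^
          ((i : ℕ) + 1) ≤ 1 := by
    rw [hI.X_eq]
    exact h
  exact ⟨I.cor312NonarchOf_of_badMass_le h', I.cor312Of_of_badMass_le h'⟩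

end ThetaData

end Literature.IUT.LogVolume

end
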